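import Literature.AlgebraicGeometry.HodgeTheory.RibetTypeEightPowersHodgeClasses
import Literature.AlgebraicGeometry.Motives.HodgeThetaSubalgebraUnitaryTenCore
import HarnessLib

/-!
# Hodge classes on all powers of abelian varieties of Ribet type `(10, n″)`, `n″ ∈ {1, 3, 7, 11, 13}`, are generated by
# divisor classes (Ribet 1983 Thm. 3 at these multiplicities — UNCONDITIONAL; `23`-FOLDS `23 = 10 + 13`)

Family `hodge`, layer `Literature/AlgebraicGeometry/HodgeTheory`. Research context: cell `pub-hodge-ring2` (HONEST
FRAMING: research route conditional on HC_CM; not a corollary; Q11.4-sentence-2 already refuted in dim ≥ 3),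
Literature lane gen 84, programme R68. UNCONDITIONAL for the class of abelian varieties it names; theorems only, no
definition, no named fact (D-0026), no `sorry`. The CELLS of the generic assembly `RibetTypeOfCoreSmulPowersHodgeClasses`
at the core `UnitaryTen.eq_top_of_smul` (`Motives/HodgeThetaSubalgebraUnitaryTenCore`), and the census they refine: in
prime dimension `p ≥ 11` the imaginary-quadratic residual of `TankeevRibet1983_hodgeClasses_divisorial_powers_simplePrimeDimension`
is `min(n′, n″) ≥ 8`, `{n′, n″} ≠ {8, 11}`, `{n′, n″} ≠ {10, 13}` (dimension `17`: `{8, 9}`; `19`: `{9, 10}`; `23`: `{8, 15}`,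
`{9, 14}`, `{11, 12}`).

THE PRINTED THEOREM. Ribet, Amer. J. Math. 105 (1983), Thm. 3 = Gordon's survey Thm. 6.3 (3) [held
`paper:arxiv-alg-geom_9709030` p. 18].

## References
* [Ribet1983] K. A. Ribet, Amer. J. Math. 105 (1983), Thm. 0 and Thm. 3.
* [Gordon1997] B. B. Gordon, *A survey of the Hodge conjecture for abelian varieties*, Thm. 6.3 (3) and Corollary.
* [MoonenZarhin1999LowDim] B. Moonen, Yu. Zarhin, Math. Ann. 315 (1999), §2 (2.4), Thm. (2.7).
* [Deligne2000] P. Deligne, *The Hodge conjecture* (Clay, 2000), §1.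
-/

noncomputable section

open CategoryTheory Module

namespace Literature.AlgebraicGeometry.HodgeTheory

open Literature.AlgebraicGeometry.Motives
open Literature.AlgebraicGeometry.Motives.HodgeStructure

section Cells

/-- **Ribet 1983 Thm. 3 at `(10, n″)`, `n″` odd, `n″ ≤ 13`, `5 ∤ n″`, `n″ ≠ 9` — UNCONDITIONAL:
`B•(A^{N+1}) = D•(A^{N+1}) ⊗ ℂ`** (core `UnitaryTen.eq_top_of_smul`).
[cite: Ribet1983, Thm. 0 and Thm. 3] [cite: Gordon1997, Thm. 6.3 (3) and Corollary] -/
theorem AbelianVariety.isDivisorGenerated_powSucc_of_ribetTypeTen (A : AbelianVariety ℂ) (φ : A ⟶ A)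
    {d : ℕ} (hd : 0 < d) (hφ : φ ≫ φ = -(d • 𝟙 A)) (hE2 : Module.finrank ℚ A.endAlgebra = 2)
    (h10 : eigenMultiplicity A φ (Complex.I * (Real.sqrt d : ℂ)) = 10)
    (hodd : Odd (eigenMultiplicity A φ (-(Complex.I * (Real.sqrt d : ℂ)))))
    (h5 : ¬ 5 ∣ eigenMultiplicity A φ (-(Complex.I * (Real.sqrt d : ℂ))))
    (h9 : eigenMultiplicity A φ (-(Complex.I * (Real.sqrt d : ℂ))) ≠ 9)
    (h13 : eigenMultiplicity A φ (-(Complex.I * (Real.sqrt d : ℂ))) ≤ 13) (N : ℕ) :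
    IsDivisorGenerated (A.powSucc N) := by
  have hpos' : 0 < eigenMultiplicity A φ (-(Complex.I * (Real.sqrt d : ℂ))) := by obtain ⟨k, hk⟩ := hodd; omega
  refine AbelianVariety.isDivisorGenerated_powSucc_of_ribetType_ofCoreSmul A φ hd hφ hE2 (by omega) hpos' ?_ N
  intro W' _ _ _ 𝔊 ι P' Q' s hbr hirr hι hιι hP' hQ' hfinP' hfinQ' hadd hsmul hsymm hPQ hdefP hdefQ hadj
  exact UnitaryTen.eq_top_of_smul hbr hirr hι hιι hP' hQ' (by rw [hfinP', h10]) (by rw [hfinQ']; exact hodd)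
    (by rw [hfinQ']; exact h5) (by rw [hfinQ']; exact h9) (by rw [hfinQ']; exact h13) hadd hsmul hsymm hPQ hdefP hdefQ
    hadj

/-- The mirror: `n_{i√d}(φ) ∈ {1, 3, 7, 11, 13}`, `n_{−i√d}(φ) = 10` (core `UnitaryTen.eq_top_of_smul'`).
[cite: Ribet1983, Thm. 0 and Thm. 3] [cite: Gordon1997, Thm. 6.3 (3) and Corollary] -/
theorem AbelianVariety.isDivisorGenerated_powSucc_of_ribetTypeTen' (A : AbelianVariety ℂ) (φ : A ⟶ A)
    {d : ℕ} (hd : 0 < d) (hφ : φ ≫ φ = -(d • 𝟙 A)) (hE2 : Module.finrank ℚ A.endAlgebra = 2)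
    (hodd : Odd (eigenMultiplicity A φ (Complex.I * (Real.sqrt d : ℂ))))
    (h5 : ¬ 5 ∣ eigenMultiplicity A φ (Complex.I * (Real.sqrt d : ℂ)))
    (h9 : eigenMultiplicity A φ (Complex.I * (Real.sqrt d : ℂ)) ≠ 9)
    (h13 : eigenMultiplicity A φ (Complex.I * (Real.sqrt d : ℂ)) ≤ 13)
    (h10 : eigenMultiplicity A φ (-(Complex.I * (Real.sqrt d : ℂ))) = 10) (N : ℕ) :
    IsDivisorGenerated (A.powSucc N) := by
  have hpos : 0 < eigenMultiplicity A φ (Complex.I * (Real.sqrt d : ℂ)) := by obtain ⟨k, hk⟩ := hodd; omega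
  refine AbelianVariety.isDivisorGenerated_powSucc_of_ribetType_ofCoreSmul A φ hd hφ hE2 hpos (by omega) ?_ N
  intro W' _ _ _ 𝔊 ι P' Q' s hbr hirr hι hιι hP' hQ' hfinP' hfinQ' hadd hsmul hsymm hPQ hdefP hdefQ hadj
  exact UnitaryTen.eq_top_of_smul' hbr hirr hι hιι hP' hQ' (by rw [hfinP']; exact hodd) (by rw [hfinP']; exact h5)
    (by rw [hfinP']; exact h9) (by rw [hfinP']; exact h13) (by rw [hfinQ', h10]) hadd hsmul hsymm hPQ hdefP hdefQ hadj

/-- **The Hodge conjecture for all powers of an abelian variety of unitary type `(10, n″)`, `n″ ∈ {1, 3, 7, 11, 13}` —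
UNCONDITIONAL** (e.g. `23`-FOLDS `(10,13)`). [cite: Ribet1983, Thm. 3] [cite: Deligne2000, §1] -/
theorem hodgeConjectureFor_powSucc_of_ribetTypeTen (A : AbelianVariety ℂ) (φ : A ⟶ A)
    {d : ℕ} (hd : 0 < d) (hφ : φ ≫ φ = -(d • 𝟙 A)) (hE2 : Module.finrank ℚ A.endAlgebra = 2)
    (h10 : eigenMultiplicity A φ (Complex.I * (Real.sqrt d : ℂ)) = 10)
    (hodd : Odd (eigenMultiplicity A φ (-(Complex.I * (Real.sqrt d : ℂ)))))
    (h5 : ¬ 5 ∣ eigenMultiplicity A φ (-(Complex.I * (Real.sqrt d : ℂ))))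
    (h9 : eigenMultiplicity A φ (-(Complex.I * (Real.sqrt d : ℂ))) ≠ 9)
    (h13 : eigenMultiplicity A φ (-(Complex.I * (Real.sqrt d : ℂ))) ≤ 13) (N : ℕ) :
    HodgeConjectureFor (A.powSucc N).dim (A.powSucc N).X :=
  hodgeConjectureFor_of_isDivisorGenerated _
    (AbelianVariety.isDivisorGenerated_powSucc_of_ribetTypeTen A φ hd hφ hE2 h10 hodd h5 h9 h13 N)

/-- **`23`-FOLDS of signature `{10, 13}`: `B• = D•` on all powers — UNCONDITIONAL.**
[cite: Ribet1983, Thm. 0 and Thm. 3] [cite: MoonenZarhin1999LowDim, §2 (2.4)] -/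
theorem AbelianVariety.isDivisorGenerated_powSucc_of_twentythreefold_tenThirteen (A : AbelianVariety ℂ)
    (φ : A ⟶ A) {d : ℕ} (hd : 0 < d) (hφ : φ ≫ φ = -(d • 𝟙 A)) (hE2 : Module.finrank ℚ A.endAlgebra = 2)
    (hX : A.dim = 23)
    (h10 : eigenMultiplicity A φ (Complex.I * (Real.sqrt d : ℂ)) = 10 ∨ eigenMultiplicity A φ (-(Complex.I * (Real.sqrt d : ℂ))) = 10)
    (N : ℕ) : IsDivisorGenerated (A.powSucc N) := by
  have hsum := eigenMultiplicity_add_eigenMultiplicity_neg_eq_dim A φ hd hφ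
  rw [hX] at hsum
  rcases h10 with h | h
  · exact AbelianVariety.isDivisorGenerated_powSucc_of_ribetTypeTen A φ hd hφ hE2 h ⟨6, by omega⟩ (by omega)
      (by omega) (by omega) N
  · exact AbelianVariety.isDivisorGenerated_powSucc_of_ribetTypeTen' A φ hd hφ hE2 ⟨6, by omega⟩ (by omega)
      (by omega) (by omega) h N

/-- **The Hodge conjecture for all powers of a `23`-FOLD of signature `{10, 13}` — UNCONDITIONAL.**
[cite: Ribet1983, Thm. 3] [cite: Deligne2000, §1] -/
theorem hodgeConjectureFor_powSucc_of_twentythreefold_tenThirteen (A : AbelianVariety ℂ)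
    (φ : A ⟶ A) {d : ℕ} (hd : 0 < d) (hφ : φ ≫ φ = -(d • 𝟙 A)) (hE2 : Module.finrank ℚ A.endAlgebra = 2)
    (hX : A.dim = 23)
    (h10 : eigenMultiplicity A φ (Complex.I * (Real.sqrt d : ℂ)) = 10 ∨ eigenMultiplicity A φ (-(Complex.I * (Real.sqrt d : ℂ))) = 10)
    (N : ℕ) : HodgeConjectureFor (A.powSucc N).dim (A.powSucc N).X :=
  hodgeConjectureFor_of_isDivisorGenerated _
    (AbelianVariety.isDivisorGenerated_powSucc_of_twentythreefold_tenThirteen A φ hd hφ hE2 hX h10 N)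

end Cells

/-! ### Census: the Tankeev–Ribet residual is `min(n′, n″) ≥ 8`, `{n′, n″} ∉ {{8, 11}, {10, 13}}` -/

section Census

/-- **The Tankeev–Ribet fact is EQUIVALENT to: (S1) `End⁰ = ℚ` in prime dimension `≥ 11`, and (S2) imaginary-quadratic
multiplicities both `≥ 8` with `{n′, n″} ≠ {8, 11}, {10, 13}`** (dimension `17`: only `{8,9}`; `19`: only `{9,10}`;
`23`: `{8,15}`, `{9,14}`, `{11,12}`). [cite: MoonenZarhin1999LowDim, §2 (2.4)–(2.7)]
[cite: Gordon1999HodgeAVSurvey, Thm. 6.3 and Corollary] [cite: Ribet1983, Thms. 1 and 3] -/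
theorem tankeevRibet1983_iff_generic_ge_eleven_and_unitary_ge_eight_ne_eightEleven_tenThirteen :
    TankeevRibet1983_hodgeClasses_divisorial_powers_simplePrimeDimension ↔
      (∀ X : AbelianVariety ℂ, X.dim.Prime → 11 ≤ X.dim → X.IsSimple → Module.finrank ℚ X.endAlgebra = 1 →
        ∀ N : ℕ, IsDivisorGenerated (X.powSucc N)) ∧
      (∀ (X : AbelianVariety ℂ) (φ : X ⟶ X) (d : ℕ), X.dim.Prime → X.IsSimple → 0 < d →
        φ ≫ φ = -(d • 𝟙 X) → Module.finrank ℚ X.endAlgebra = 2 →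
        8 ≤ eigenMultiplicity X φ (Complex.I * (Real.sqrt d : ℂ)) →
        8 ≤ eigenMultiplicity X φ (-(Complex.I * (Real.sqrt d : ℂ))) →
        ¬ (eigenMultiplicity X φ (Complex.I * (Real.sqrt d : ℂ)) = 8 ∧
            eigenMultiplicity X φ (-(Complex.I * (Real.sqrt d : ℂ))) = 11) →
        ¬ (eigenMultiplicity X φ (Complex.I * (Real.sqrt d : ℂ)) = 11 ∧
            eigenMultiplicity X φ (-(Complex.I * (Real.sqrt d : ℂ))) = 8) →
        ¬ (eigenMultiplicity X φ (Complex.I * (Real.sqrt d : ℂ)) = 10 ∧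
            eigenMultiplicity X φ (-(Complex.I * (Real.sqrt d : ℂ))) = 13) →
        ¬ (eigenMultiplicity X φ (Complex.I * (Real.sqrt d : ℂ)) = 13 ∧
            eigenMultiplicity X φ (-(Complex.I * (Real.sqrt d : ℂ))) = 10) →
        ∀ N : ℕ, IsDivisorGenerated (X.powSucc N)) := by
  rw [tankeevRibet1983_iff_generic_ge_eleven_and_unitary_ge_eight_ne_eightEleven]
  refine ⟨fun ⟨hS1, hS8⟩ => ⟨hS1, fun X φ d hp hs hd hφ he2 ha hb h1 h2 _ _ N =>
    hS8 X φ d hp hs hd hφ he2 ha hb h1 h2 N⟩, fun ⟨hS1, hS8'⟩ => ⟨hS1, ?_⟩⟩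
  intro X φ d hp hs hd hφ he2 ha hb h1 h2 N
  by_cases h1013 : eigenMultiplicity X φ (Complex.I * (Real.sqrt d : ℂ)) = 10 ∧
      eigenMultiplicity X φ (-(Complex.I * (Real.sqrt d : ℂ))) = 13
  · obtain ⟨h10, h13⟩ := h1013
    exact AbelianVariety.isDivisorGenerated_powSucc_of_ribetTypeTen X φ hd hφ he2 h10 ⟨6, by omega⟩ (by omega)
      (by omega) (by omega) N
  by_cases h1310 : eigenMultiplicity X φ (Complex.I * (Real.sqrt d : ℂ)) = 13 ∧
      eigenMultiplicity X φ (-(Complex.I * (Real.sqrt d : ℂ))) = 10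
  · obtain ⟨h13, h10⟩ := h1310
    exact AbelianVariety.isDivisorGenerated_powSucc_of_ribetTypeTen' X φ hd hφ he2 ⟨6, by omega⟩ (by omega)
      (by omega) (by omega) h10 N
  exact hS8' X φ d hp hs hd hφ he2 ha hb h1 h2 h1013 h1310 N

end Census

end Literature.AlgebraicGeometry.HodgeTheory

end
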